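import Summits.BirchSwinnertonDyer.BirchSwinnertonDyer.Theorems.SchneiderFreeAdditiveX3GordCellThreeOfPrint
import Summits.BirchSwinnertonDyer.BirchSwinnertonDyer.Theorems.SchneiderFreeAdditiveX3GoodMemberLine
import HarnessLib

/-!
# Route `SchneiderFreeAdditiveX3` (K1 door): under the non-anomalous clause `hna` the curve ITSELF satisfies two of Keller–Yin's
# per-curve hypotheses — the lattice normalisation «a rational `p`-line on which `D_p` is non-trivial» and «no rational `p`-torsion»
# — so the `p = 3` per-datum door of `…GordCellThreeOfPrint` needs only `W(K)[3] = 0` among them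

Cell `bsd-schneider-ideate`, seat `bsd-schneider-door-c5` (prover, generation 26; assembly layer; `--supports` 19177).
PARTITION: board row B6 ∩ X3 ∩ sst-twist, `r = 1`, (G-ord, `e = 2`) half at `p = 3` (686 NAT pairs) — bookkeeping on top of
`…GordCellThreeOfPrint` (p680959); types-the-object-of nothing; closes none of B6's cells (BSD NOT advanced).  bears_on: K1-door (19177).

WHAT.  The per-datum door `KYBranchThreeDoor.additiveIMCLowerBDPOnTree_subGordTwo_three_offSliver_self` displays Keller–Yin's per-curve
hypotheses `hlat` (a rational `3`-line `Φ` with `¬ LineDecompositionTrivialAt W 3 Φ`) and `htf` (`W(K)[3] = 0`).  The first is AUTOMATIC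
on the non-anomalous cell: the clause `hna` («no decomposition group above `3` fixes a rational line pointwise …») is, at any rational
line (one exists: `Red`), the negation of `LineDecompositionTrivialAt` (§1).  The second is automatic too (a `K`-rational `3`-torsion
point would make `φ′` or `ψ′` trivial on `D_𝔓 ≤ Γ_K` for the SPLIT prime — the anomalous case), but its kernel form needs «the
decomposition groups at a prime split in `ℚ(√d_K)` fix `√d_K`», not in the tree; §2 records the `ℚ`-rational half (no rational point of
order `p` under `hna`, Mazur's étale-line argument as in `GoodMember.addOrderOf_ne` with UNIQUENESS of the line replaced by `hna` at
EVERY line) and §3 the per-datum door at `p = 3` with `hlat` discharged.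

* §1 `exists_isRationalLine_not_lineDecompositionTrivialAt_of_hna` (any odd `p`), `…_of_subGordTwo_of_forall_twist_three`.
* §2 `addOrderOf_ne_of_hna` — no rational point of order `p` on `W` under `hna`.
* §3 **`additiveIMCLowerBDPOnTree_subGordTwo_three_offSliver_of_torsionFree`** — `…_self` without `hlat`.

HONEST FRAMING: theorems only; compositions of tree theorems CONDITIONAL on the displayed hypotheses of `…GordCellThreeOfPrint`
([DIV.dvd] and [AN3] claim-tagged; [BR3] and eleven facts published, typed); nothing closed; BSD proved for no curve; «closes rung: none».
References: Keller–Yin arXiv:2410.23241 §3.1/§3.3 (the hypotheses `φ|_{G_p} ≠ 𝟙`, `E(K)[p] = 0`) [KellerYin2024b]; Mazur 1977 III §5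
[Mazur1977]; CGLS 2022 §1.2 [CastellaGrossiLeeSkinner2022].
-/

set_option autoImplicit false
-- `Summit.<P>.<Sub>` repeats `BirchSwinnertonDyer` by the tree's layout convention (D-0017)
set_option linter.dupNamespace false

noncomputable section

open scoped Classical NumberField

open Field NumberField IsDedekindDomain WeierstrassCurve PowerSeries Rat.HeightOneSpectrum
  Literature.NumberTheory.EllipticCurves Literature.NumberTheory.EllipticCurves.GreenbergSelmer
  Literature.NumberTheory.GaloisRepresentations Literature.NumberTheory.GaloisCohomology
  Literature.NumberTheory.EllipticCurves.ModularForms Literature.NumberTheory.EllipticCurves.Rank1Residual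
  Literature.NumberTheory.EllipticCurves.KellerYin2024 Literature.NumberTheory.EllipticCurves.CaiShuTian2014
  Literature.NumberTheory.IwasawaTheory Literature.NumberTheory.IwasawaTheory.Greenberg2016
  Literature.NumberTheory.IwasawaTheory.Greenberg2006
  Summit.BirchSwinnertonDyer.Rank1Residual Summit.BirchSwinnertonDyer.Rank1Residual.X11b
  Summit.BirchSwinnertonDyer.Rank1Residual.X11b.AcSelmer Summit.BirchSwinnertonDyer.Rank1Residual.X11b.Halves
  Summit.BirchSwinnertonDyer.Rank1Residual.X11b.CongruenceLimit
  Summit.BirchSwinnertonDyer.Rank1Residual.Additive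
  Summit.BirchSwinnertonDyer.BirchSwinnertonDyer.Theorems.SchneiderFree
  Summit.BirchSwinnertonDyer.BirchSwinnertonDyer.Theorems.SchneiderFree.KYRead
  Summit.BirchSwinnertonDyer.BirchSwinnertonDyer.Theses.SchneiderFreeAdditiveX3
  Summit.BirchSwinnertonDyer.BirchSwinnertonDyer.Theorems.SchneiderFreeAdditiveX3.LZZMatch
  Summit.BirchSwinnertonDyer.BirchSwinnertonDyer.Theorems.SchneiderFreeAdditiveX3.ControlDischarged
  Summit.BirchSwinnertonDyer.BirchSwinnertonDyer.Theorems.SchneiderFreeAdditiveX3.KYBranchOnly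
  Summit.BirchSwinnertonDyer.BirchSwinnertonDyer.Theorems.SchneiderFreeAdditiveX3.KYBranchThree
  Summit.BirchSwinnertonDyer.BirchSwinnertonDyer.Theorems.SchneiderFreeAdditiveX3.KYBranchThreeDoor
  Summit.BirchSwinnertonDyer.BirchSwinnertonDyer.Theorems.SchneiderFreeAdditiveX3.KYNonAnomalousTwist
open Literature.NumberTheory.EllipticCurves.CastellaGrossiLeeSkinner2022
  (cor126_residualCharacter_globalLift cor126_residualCharacter_localSurjective
    prop125_characterGrSelmerDual_torsion_muZero_dim prop14_residualCharacterSelmer_finite IsKatzLFunction)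

namespace Summit.BirchSwinnertonDyer.BirchSwinnertonDyer.Theorems.SchneiderFreeAdditiveX3.KYBranchThreeLattice

/-! ### §1 `hna` ⟹ Keller–Yin's lattice normalisation, for the curve itself -/

/-- **Under `hna` every rational `p`-line is non-trivial on the decomposition groups at `p`; with `Red W p` one exists** — so
Keller–Yin's lattice hypothesis «some rational line `Φ` with `φ|_{G_p} ≠ 𝟙`» (`¬ LineDecompositionTrivialAt W p Φ`) holds for `W`
itself.  (`LineDecompositionTrivialAt` asks EVERY `D_𝔓`, `𝔓 ∣ p`, to fix `Φ` pointwise; `hna` denies it at the place `v ∋ p` and the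
prime `adicCompletionPrime ℚ v`.) [cite: KellerYin2024b, §3.3 (the normalisation φ|_{G_p} ≠ 𝟙, arXiv:2410.23241 p. 17)]
[cite: CastellaGrossiLeeSkinner2022, §1.2 (hypothesis θ|_{G_v̄} ≠ 𝟙, ω)] -/
theorem exists_isRationalLine_not_lineDecompositionTrivialAt_of_hna {W : WeierstrassCurve ℚ} [W.IsElliptic] {p : ℕ}
    [hp : Fact p.Prime] (hred : Red W p)
    (hna : ∀ (v : HeightOneSpectrum (𝓞 ℚ)), ((p : ℕ) : 𝓞 ℚ) ∈ v.asIdeal →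
      ∀ (Φ : AddSubgroup (geomTorsion W (p : ℤ))), IsRationalLine W p Φ →
      ∀ 𝔓 ∈ v.primesAbove,
        (¬ ∀ g ∈ 𝔓.decompositionSubgroup (absoluteGaloisGroup ℚ), ∀ P ∈ Φ, g • P = P) ∧
          (¬ ∀ g ∈ 𝔓.decompositionSubgroup (absoluteGaloisGroup ℚ),
            ∀ P : geomTorsion W (p : ℤ), g • P - P ∈ Φ)) :
    ∃ Φ : AddSubgroup (geomTorsion W (p : ℤ)), IsRationalLine W p Φ ∧ ¬ LineDecompositionTrivialAt W p Φ := by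
  obtain ⟨Φ, hΦ⟩ := exists_isRationalLine_of_not_irr W p hred
  obtain ⟨v, hpv⟩ := Literature.NumberTheory.NumberFields.RingOfIntegers.exists_heightOneSpectrum_natCast_mem ℚ hp.out
  refine ⟨Φ, hΦ, fun htriv ↦ ?_⟩
  exact (hna v hpv Φ hΦ _ (adicCompletionPrime_mem_primesAbove ℚ v)).1
    (fun g hg P hP ↦ htriv v hpv _ (adicCompletionPrime_mem_primesAbove ℚ v) g hg P hP)

/-- **The (G-ord, `e = 2`) cell at `p = 3` with non-anomalous twists: the curve ITSELF carries Keller–Yin's lattice normalisation.**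
[cite: KellerYin2024b, §3.3 (arXiv:2410.23241 p. 17)] [cite: CastellaGrossiLeeSkinner2022, §1.2] -/
theorem exists_isRationalLine_not_lineDecompositionTrivialAt_of_subGordTwo_of_forall_twist_three
    (W : WeierstrassCurve ℚ) [W.IsElliptic] [W.IsGloballyMinimal] (hX : ClassX3 W 3) (hSG : SubGordTwo W 3)
    (hna : ∀ (V : WeierstrassCurve ℚ) [V.IsElliptic] [V.IsGloballyMinimal] (C : VariableChange ℚ),
      GoodOrd V 3 → C • V.quadraticTwist ((-1 : ℚ) ^ (3 / 2) * (3 : ℕ)) = W → ¬ (3 : ℤ) ∣ V.frobeniusTrace 3 - 1) :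
    ∃ Φ : AddSubgroup (geomTorsion W (3 : ℤ)), IsRationalLine W 3 Φ ∧ ¬ LineDecompositionTrivialAt W 3 Φ :=
  exists_isRationalLine_not_lineDecompositionTrivialAt_of_hna hX.1
    (hna_isRationalLine_of_subGordTwo_of_forall_twist W (by norm_num) hX hSG hna)

/-! ### §2 `hna` ⟹ no rational point of order `p` -/

/-- **No rational point of order `p` under `hna`** (`p` odd): the geometric image of such a point is a non-zero `Γ_ℚ`-fixed point of
`E[p]` (tree `exists_geomTorsion_of_addOrderOf_eq`, Mazur III §5), whose span is a rational line FIXED POINTWISE by `Γ_ℚ ⊇ D_𝔓` —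
forbidden by `hna`.  (Door-c4 g7's `GoodMember.addOrderOf_ne` with the uniqueness of the line replaced by `hna` at every line.)
[cite: Mazur1977, Ch. III §5, p. 157] [cite: CastellaGrossiLeeSkinner2022, §1.2 (hypothesis θ|_{G_v̄} ≠ 𝟙)] -/
theorem addOrderOf_ne_of_hna {W : WeierstrassCurve ℚ} [W.IsElliptic] {p : ℕ} [hp : Fact p.Prime]
    (hna : ∀ (v : HeightOneSpectrum (𝓞 ℚ)), ((p : ℕ) : 𝓞 ℚ) ∈ v.asIdeal →
      ∀ (Φ : AddSubgroup (geomTorsion W (p : ℤ))), IsRationalLine W p Φ →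
      ∀ 𝔓 ∈ v.primesAbove,
        (¬ ∀ g ∈ 𝔓.decompositionSubgroup (absoluteGaloisGroup ℚ), ∀ P ∈ Φ, g • P = P) ∧
          (¬ ∀ g ∈ 𝔓.decompositionSubgroup (absoluteGaloisGroup ℚ),
            ∀ P : geomTorsion W (p : ℤ), g • P - P ∈ Φ))
    (R : W.toAffine.Point) : addOrderOf R ≠ p := by
  haveI : NeZero (p : ℚ) := ⟨Nat.cast_ne_zero.mpr hp.out.ne_zero⟩
  intro hR
  obtain ⟨P₁, -, hP₁0, hP₁fix⟩ := exists_geomTorsion_of_addOrderOf_eq W hR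
  have hord : addOrderOf P₁ = p := addOrderOf_eq_of_ne_zero W p hP₁0
  have hline : IsRationalLine W p (AddSubgroup.zmultiples P₁) := by
    refine ⟨by rw [Nat.card_zmultiples, hord], fun σ Q hQ ↦ ?_⟩
    obtain ⟨m, rfl⟩ := AddSubgroup.mem_zmultiples_iff.mp hQ
    rw [smul_comm σ m P₁, hP₁fix σ]
    exact AddSubgroup.zsmul_mem _ (AddSubgroup.mem_zmultiples P₁) m
  obtain ⟨v, hpv⟩ := Literature.NumberTheory.NumberFields.RingOfIntegers.exists_heightOneSpectrum_natCast_mem ℚ hp.out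
  refine (hna v hpv _ hline _ (adicCompletionPrime_mem_primesAbove ℚ v)).1 fun g _ Q hQ ↦ ?_
  obtain ⟨m, rfl⟩ := AddSubgroup.mem_zmultiples_iff.mp hQ
  rw [smul_comm g m P₁, hP₁fix g]

/-! ### §3 The per-datum door at `p = 3` with the lattice normalisation discharged -/

/-- **The (G-ord, `e = 2`) lower socket AT `p = 3` off the sliver, non-anomalous twists, per datum — `…_self` with `hlat` DISCHARGED (§1):**
the only per-curve Keller–Yin hypothesis still displayed is `W(K)[3] = 0` at the datum's field (automatic as well — the anomalous case is
excluded — pending the kernel lemma «decomposition groups at a prime split in `ℚ(√d_K)` fix `√d_K`»), next to the comparison data `hAUX`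
and the named inputs (Kolyvagin, modularity, Hsieh A, LZZ, Castella–Hsieh signed, [DIV.dvd], [AN3], [BR3], eleven published facts).
CONDITIONAL; nothing asserted about BSD. [claim: KellerYin2024PotOrd, status: under-review]
[cite: KellerYin2024b, Thm. 3.3.6, Prop. 3.4.4, Thm. 3.5.1 (arXiv:2410.23241 pp. 19–20) (preprint; the Kolyvagin clause a hypothesis)]
[cite: CastellaGrossiLeeSkinner2022, Thms. 1.2.2, 2.1.2, 2.2.2, Prop. 14] [cite: CastellaHsieh2018, §3.3, Def. 3.7, Prop. 3.8] -/
theorem additiveIMCLowerBDPOnTree_subGordTwo_three_offSliver_of_torsionFree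
    (hKo : ∀ (N : ℕ) [NeZero N] (W : WeierstrassCurve ℚ) (K : Type) [Field K] [NumberField K],
      Literature.NumberTheory.EllipticCurves.kolyvagin N W K)
    (hPar : nonempty_modularParametrizationData)
    (hA : Hsieh2014.thmA_exists_isHsiehLFunction_unrPeriod_anyLevel)
    (hL : LiuZhangZhang2018.thm151_thm153_modularCurve_heegnerVector_additive)
    (hCHσ : castellaHsieh2018_exists_isBranchBDPLFunction_signed)
    (hDVD : thm336_dvd_branch_OPEN) (hAN : thm351_anacong_branch_three) (hBR : thm122_charLambda_pair_three)
    (hprop125 : prop125_characterGrSelmerDual_torsion_muZero_dim) (hfact : prop14_residualCharacterSelmer_finite)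
    (hlift : cor126_residualCharacter_globalLift) (hlocal : cor126_residualCharacter_localSurjective)
    (h411 : prop411_selmer_isAlmostDivisible) (h263 : prop263_sur_of_crk) (h41 : prop41_globalEulerPoincareCorank)
    (h42 : prop42_localEulerPoincareCorank) (h5A : sec5A_localH2_subsingleton_of_LOC1)
    (h32 : prop32_cohomology_isCofinitelyGenerated) :
    ∀ (W : WeierstrassCurve ℚ) [W.IsElliptic] [W.IsGloballyMinimal],
      W.analyticRank = 1 → ClassX3 W 3 → SubGordTwo W 3 →
      (∀ (V : WeierstrassCurve ℚ) [V.IsElliptic] [V.IsGloballyMinimal] (C : VariableChange ℚ),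
        GoodOrd V 3 → C • V.quadraticTwist ((-1 : ℚ) ^ (3 / 2) * (3 : ℕ)) = W → ¬ (3 : ℤ) ∣ V.frobeniusTrace 3 - 1) →
      ∀ (N : ℕ) [NeZero N] (K : Type) [Field K] [NumberField K]
        (Dt : ModularParametrizationData W N) (H : HeegnerDatum N (NumberField.discr K)) (ι : K →+* ℂ)
        (P : (W.baseChange K).toAffine.Point),
        W.analyticRank = 1 → Additive.N10.Locus W 3 → W.conductorNorm ℤ = N → IsImaginaryQuadratic K →
        Odd (NumberField.discr K) → ¬ 3 ∣ Units.torsionOrder K → SatisfiesHeegnerHypothesis N K →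
        (W.quadraticTwist (NumberField.discr K : ℚ)).entireLFunction 1 ≠ 0 →
        WeierstrassCurve.Affine.Point.map ι.toRatAlgHom P = heegnerPointComplex Dt H →
        ¬ IsOfFinAddOrder P → NumberField.discr K ≠ -3 →
        (∀ Q : (W.baseChange K).toAffine.Point, 3 • Q = 0 → Q = 0) →
        ∀ (κ : ZpExtension K 3), κ.IsAnticyclotomic →
          ∀ (γ : Field.absoluteGaloisGroup K) [Fact (κ.IsTopGenerator γ)]
            (𝔭 : HeightOneSpectrum (𝓞 K)) (h𝔭 : ((3 : ℕ) : 𝓞 K) ∈ 𝔭.asIdeal)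
            (he : 𝔭.asIdeal.ramificationIdx (𝓞 ℚ) = 1) (hf : 𝔭.asIdeal.inertiaDeg (𝓞 ℚ) = 1),
            (∀ (𝔮 : HeightOneSpectrum (𝓞 K)), ((3 : ℕ) : 𝓞 K) ∈ 𝔮.asIdeal → 𝔭 ≠ 𝔮 →
              ∀ (ι' : PadicAlgCl 3 ≃+* ℂ), BranchInducesPrime 3 ι' 𝔮 →
                ∃ (θsub θquot θ₀ : FramedGaloisRep K (padicCoeffIntegers (∅ : Set (PadicAlgCl 3))) 1)
                  (θ₀K : HeckeCharacter K) (Cbar : Finset (HeightOneSpectrum (𝓞 K)))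
                  (ΩK₀ : ℂ) (Ωp₀ : (unrIntegers 3)ˣ) (Lφ : UnrSeries 3),
                  IsResidualPairOver (W.baseChange K) 3 θsub θquot ∧ (θ₀ = θsub ∨ θ₀ = θquot) ∧
                    IsHeckeCharOf ι' θ₀ θ₀K ∧ θ₀K.IsUnramifiedAt 𝔮 ∧ θ₀K.IsUnramifiedAt 𝔭 ∧
                    (∀ u ∈ Cbar, ¬ θ₀K.IsUnramifiedAt u) ∧ ΩK₀ ≠ 0 ∧
                    IsKatzLFunction ι' 𝔮 𝔭 Cbar κ γ θ₀K ΩK₀ ((Ωp₀ : unrIntegers 3) : ℂ_[3]) Lφ) →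
            AdditiveIMCLowerBDPOnTreeLeAt 3 κ 𝔭 γ (embAt K 3 𝔭 h𝔭 he hf) (padicValNat 3 Dt.c.natAbs) P := by
  intro W _ _ hr hX hS hna
  exact additiveIMCLowerBDPOnTree_subGordTwo_three_offSliver_self hKo hPar hA hL hCHσ hDVD hAN hBR hprop125 hfact hlift hlocal
    h411 h263 h41 h42 h5A h32 W hr hX hS hna
    (exists_isRationalLine_not_lineDecompositionTrivialAt_of_subGordTwo_of_forall_twist_three W hX hS hna)

end Summit.BirchSwinnertonDyer.BirchSwinnertonDyer.Theorems.SchneiderFreeAdditiveX3.KYBranchThreeLattice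

end
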